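import Mathlib.RingTheory.SimpleModule.Basic
import Mathlib.LinearAlgebra.Projection
import Mathlib.LinearAlgebra.FiniteDimensional.Defs
import Mathlib.RingTheory.TensorProduct.Free
import Mathlib.RingTheory.IsTensorProduct
import Literature.RingTheory.SimpleModule.SemisimpleBaseChange
import Literature.AlgebraicGeometry.Motives.MumfordTateInvariantsScalarExtension
import HarnessLib

/-!
# Completely reducible operator families: enveloping algebra, bicommutant, extension of scalars

Pure algebra for the proof of `Deligne1982_mumfordTateInvariants_baseChange` (complete
reducibility of `MT(H)(K)` from that of `MT(H)(ℚ)`). Let `k` be a field, `T` a finite-dimensional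
`k`-vector space and `G ⊆ End_k(T)` a family of operators which is **completely reducible**:
every `G`-stable subspace has a `G`-stable complement. Let `A = k[G] ⊆ End_k(T)` be the
subalgebra generated by `G` (`Algebra.adjoin k G`). We prove:

* `isSemisimpleModule_adjoin`, `isSemisimpleRing_adjoin`: `T` is a semisimple `A`-module and
  `A` is a semisimple ring (it embeds `A`-linearly into `T^m`);
* `mem_adjoin_of_forall_commute` — the **bicommutant (Jacobson density) theorem** in finite
  dimension: an operator commuting with every operator that commutes with `G` lies in `A`
  (Bourbaki, *Algèbre* VIII, §5 no 5, Thm. 3 (Jacobson) and Lemme 3; proof by the classical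
  "`T^m` trick" printed there);
* `isBaseChange_baseChangeHom`: `End_K(K ⊗ T)` is the base change of `End_k(T)` along
  `f ↦ f_K = 1 ⊗ f`;
* `mem_span_baseChange_adjoin_of_forall_commute`: over any field `K ⊇ k`, an operator on
  `K ⊗_k T` commuting with all `f_K`, `f` in the commutant of `G`, lies in the `K`-span of the
  `a_K`, `a ∈ A` (bicommutant + "invariants commute with extension of scalars",
  `mem_span_image_of_forall_of_isBaseChange`);
* `exists_isCompl_of_forall_baseChange_adjoin` (needs `char k = 0`): every `K`-subspace of
  `K ⊗_k T` stable under the `g_K`, `g ∈ G`, has a complement stable under the whole `K`-span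
  of the `a_K`, `a ∈ A` — because `K ⊗_k A` is semisimple
  (`Literature.RingTheory.SimpleModule.isSemisimpleRing_baseChange`, Pierce, *Associative
  Algebras*, §10.7 Cor. b) and so is its image in `End_K(K ⊗ T)`.

## References

* [BourbakiAlgebreVIII2012] N. Bourbaki, *Algèbre, Chapitre 8: Modules et anneaux
  semi-simples*, 2e éd. (2012), VIII §5 no 5, Théorème 3 (Jacobson) and Lemme 3 (held:
  `book:bourbaki2012-algebre`, PDF p. 93, read).
* [Pierce1982] R. S. Pierce, *Associative Algebras*, GTM 88 (1982), §10.7 Cor. b.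
* P. Deligne, *Hodge cycles on abelian varieties*, LNM 900 (1982), I, Prop. 3.1 and its proof.

## Design

Theorems only, no definitions and no named facts (D-0026); the hypotheses "`G`-stable" are
spelled out as `∀ g ∈ G, ∀ w ∈ W, g w ∈ W`. `namespace Literature.AlgebraicGeometry.Motives`.
-/

noncomputable section

open scoped TensorProduct

namespace Literature.AlgebraicGeometry.Motives

universe u v w

section Field

variable {k : Type u} [Field k] {T : Type v} [AddCommGroup T] [Module k T]

/-! ### Stable subspaces are the submodules of the enveloping algebra -/

/-- A subspace stable under `G` is stable under the algebra `k[G]` generated by `G`. [folklore] -/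
theorem adjoin_apply_mem_of_forall_mem {G : Set (Module.End k T)} {W : Submodule k T}
    (hW : ∀ g ∈ G, ∀ w ∈ W, g w ∈ W) {a : Module.End k T} (ha : a ∈ Algebra.adjoin k G)
    {w : T} (hw : w ∈ W) : a w ∈ W := by
  induction ha using Algebra.adjoin_induction generalizing w with
  | mem g hg => exact hW g hg w hw
  | algebraMap r => simpa using W.smul_mem r hw
  | add a b _ _ iha ihb => simpa using W.add_mem (iha hw) (ihb hw)
  | mul a b _ _ iha ihb => simpa using iha (ihb hw)

/-- The `k[G]`-submodule structure on a `G`-stable subspace. [folklore] -/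
theorem exists_submodule_adjoin_of_forall_mem {G : Set (Module.End k T)} {W : Submodule k T}
    (hW : ∀ g ∈ G, ∀ w ∈ W, g w ∈ W) :
    ∃ W' : Submodule (Algebra.adjoin k G) T, W'.restrictScalars k = W :=
  ⟨{ carrier := W
     add_mem' := W.add_mem
     zero_mem' := W.zero_mem
     smul_mem' := fun a _ hw => adjoin_apply_mem_of_forall_mem hW a.2 hw }, rfl⟩

/-- A `k[G]`-submodule is `G`-stable. [folklore] -/
theorem apply_mem_of_mem_restrictScalars {G : Set (Module.End k T)}
    (W : Submodule (Algebra.adjoin k G) T) {g : Module.End k T} (hg : g ∈ G) {w : T}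
    (hw : w ∈ W.restrictScalars k) : g w ∈ W.restrictScalars k := by
  have h := W.smul_mem ⟨g, Algebra.subset_adjoin hg⟩ (Submodule.restrictScalars_mem k W w |>.1 hw)
  exact h

/-! ### Complete reducibility: the enveloping algebra is semisimple -/

section CompletelyReducible

variable {G : Set (Module.End k T)}
  (hG : ∀ W : Submodule k T, (∀ g ∈ G, ∀ w ∈ W, g w ∈ W) →
    ∃ W' : Submodule k T, (∀ g ∈ G, ∀ w ∈ W', g w ∈ W') ∧ IsCompl W W')
include hG

/-- **A completely reducible family makes `T` a semisimple `k[G]`-module.** [folklore] -/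
theorem isSemisimpleModule_adjoin : IsSemisimpleModule (Algebra.adjoin k G) T := by
  refine (isSemisimpleModule_iff _ _).2 ⟨fun W => ?_⟩
  obtain ⟨W', hW', hc⟩ := hG (W.restrictScalars k) fun g hg w hw => apply_mem_of_mem_restrictScalars W hg hw
  obtain ⟨W'', rfl⟩ := exists_submodule_adjoin_of_forall_mem hW'
  refine ⟨W'', ?_⟩
  rw [isCompl_iff, disjoint_iff, codisjoint_iff] at hc ⊢
  constructor
  · apply Submodule.restrictScalars_injective k
    rw [Submodule.restrictScalars_inf, hc.1, Submodule.restrictScalars_bot]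
  · apply Submodule.restrictScalars_injective k
    rw [Submodule.restrictScalars_sup, hc.2, Submodule.restrictScalars_top]

variable [FiniteDimensional k T]

/-- **The enveloping algebra `k[G]` of a completely reducible family is a semisimple ring**:
`a ↦ (a tᵢ)ᵢ` embeds `k[G]` into the semisimple `k[G]`-module `T^m` (`tᵢ` a basis of `T`).
[folklore] -/
theorem isSemisimpleRing_adjoin : IsSemisimpleRing (Algebra.adjoin k G) := by
  haveI := isSemisimpleModule_adjoin hG
  let t := Module.finBasis k T
  let j : Algebra.adjoin k G →ₗ[Algebra.adjoin k G] (Fin (Module.finrank k T) → T) :=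
    LinearMap.pi fun i => LinearMap.toSpanSingleton (Algebra.adjoin k G) T (t i)
  refine IsSemisimpleModule.of_injective j fun a b hab => ?_
  apply Subtype.ext
  refine t.ext fun i => ?_
  have := congr_fun hab i
  simp only [j, LinearMap.pi_apply, LinearMap.toSpanSingleton_apply] at this
  exact this

/-- **Bicommutant theorem** (Jacobson density, finite-dimensional case): if `G` is completely
reducible on the finite-dimensional `T`, an operator `x` commuting with every operator that
commutes with `G` lies in the algebra `k[G]` generated by `G` (Bourbaki, *Algèbre* VIII, §5 no 5,
Thm. 3: an element of the bicommutant of a semisimple module coincides with a homothety `a_M` on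
every finite subset — here on a basis, so it IS `a_M`). Proof as printed there: in the semisimple
`k[G]`-module `T^m` the cyclic submodule through a basis `t = (tᵢ)` has a stable complement
(Lemme 3); the entries of the corresponding `k[G]`-linear projection commute with `G`, hence
with `x`, so `(x tᵢ)ᵢ = x^{(m)} t` lies in `k[G] · t`, i.e. `x tᵢ = a tᵢ` for some `a ∈ k[G]`.
[cite: BourbakiAlgebreVIII2012, VIII §5 no 5, Thm. 3 (Jacobson) and Lemme 3, PDF p. 93] -/
theorem mem_adjoin_of_forall_commute {x : Module.End k T}
    (hx : ∀ f : Module.End k T, (∀ g ∈ G, f * g = g * f) → x * f = f * x) :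
    x ∈ Algebra.adjoin k G := by
  classical
  haveI := isSemisimpleModule_adjoin hG
  set A := Algebra.adjoin k G
  set m := Module.finrank k T
  let t := Module.finBasis k T
  -- the cyclic submodule through `t` in `T^m` and a stable complement
  let N : Submodule A (Fin m → T) := Submodule.span A {(⇑t : Fin m → T)}
  obtain ⟨N', hN⟩ := exists_isCompl N
  let p : (Fin m → T) →ₗ[A] (Fin m → T) := Submodule.projection N N' hN
  -- the entries of `p` commute with `G`, hence with `x`
  let q : Fin m → Fin m → Module.End k T := fun i l =>
    (LinearMap.proj i ∘ₗ p.restrictScalars k) ∘ₗ LinearMap.single k (fun _ => T) l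
  have hq : ∀ i l, x * q i l = q i l * x := by
    intro i l
    refine hx _ fun g hg => LinearMap.ext fun w => ?_
    have hsmul : p ((⟨g, Algebra.subset_adjoin hg⟩ : A) • Pi.single l w) =
        (⟨g, Algebra.subset_adjoin hg⟩ : A) • p (Pi.single l w) := map_smul p _ _
    have h1 : ((⟨g, Algebra.subset_adjoin hg⟩ : A) • (Pi.single l w : Fin m → T)) = Pi.single l (g w) := by
      ext i'
      by_cases h : i' = l
      · subst h; simp; rfl
      · simp [h]
    have h2 := congr_fun hsmul i
    simp only [Pi.smul_apply] at h2
    simp only [q, Module.End.mul_apply, LinearMap.comp_apply, LinearMap.coe_single,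
      LinearMap.coe_restrictScalars, LinearMap.proj_apply]
    rw [← h1, h2]
    rfl
  -- `u ↦ (x uᵢ)ᵢ` commutes with `p`
  have hcomm : ∀ u : Fin m → T, p (fun i => x (u i)) = fun i => x (p u i) := by
    intro u
    have hu : u = ∑ l, Pi.single l (u l) := (Finset.univ_sum_single u).symm
    have hxu : (fun i => x (u i)) = ∑ l, Pi.single l (x (u l)) := by
      rw [Finset.univ_sum_single]
    rw [hxu, map_sum]
    conv_rhs => rw [hu, map_sum]
    ext i
    simp only [Finset.sum_apply, map_sum]
    refine Finset.sum_congr rfl fun l _ => ?_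
    have := LinearMap.congr_fun (hq i l) (u l)
    simpa [q] using this.symm
  -- `t ∈ N`, so `(x tᵢ)ᵢ = p (x tᵢ)ᵢ ∈ N = A • t`
  have ht : (⇑t : Fin m → T) ∈ N := Submodule.subset_span rfl
  have hxt : (fun i => x (t i)) ∈ N := by
    have h := hcomm t
    rw [Submodule.projection_apply_of_mem_left hN ht] at h
    rw [← h]
    exact Submodule.projection_apply_mem hN _
  obtain ⟨a, ha⟩ := Submodule.mem_span_singleton.1 hxt
  have hxa : x = (a : Module.End k T) := t.ext fun i => by
    have := congr_fun ha i
    simp only [Pi.smul_apply] at this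
    exact this.symm
  rw [hxa]
  exact a.2

end CompletelyReducible

/-! ### Extension of scalars: the bicommutant and complete reducibility over `K ⊇ k` -/

section BaseChange

variable (K : Type w) [Field K] [Algebra k K]

/-- `Module.End.baseChangeHom` is `f ↦ f_K`. [folklore] -/
theorem baseChangeHom_apply (f : Module.End k T) :
    Module.End.baseChangeHom k K T f = f.baseChange K :=
  rfl

/-- A `K`-subspace of `K ⊗ T` stable under the `g_K`, `g ∈ G`, is stable under `a_K` for every
`a ∈ k[G]`. [folklore] -/
theorem baseChange_apply_mem_of_mem_adjoin {G : Set (Module.End k T)} {W : Submodule K (K ⊗[k] T)}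
    (hW : ∀ g ∈ G, ∀ w ∈ W, g.baseChange K w ∈ W) {a : Module.End k T}
    (ha : a ∈ Algebra.adjoin k G) {w : K ⊗[k] T} (hw : w ∈ W) : a.baseChange K w ∈ W := by
  induction ha using Algebra.adjoin_induction generalizing w with
  | mem g hg => exact hW g hg w hw
  | algebraMap r =>
    have h1 : (algebraMap k (Module.End k T) r).baseChange K = r • (1 : Module.End K (K ⊗[k] T)) := by
      rw [Algebra.algebraMap_eq_smul_one, LinearMap.baseChange_smul, LinearMap.baseChange_one]
    rw [h1, LinearMap.smul_apply, Module.End.one_apply]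
    exact W.smul_of_tower_mem r hw
  | add a b _ _ iha ihb =>
    rw [LinearMap.baseChange_add, LinearMap.add_apply]
    exact W.add_mem (iha hw) (ihb hw)
  | mul a b _ _ iha ihb =>
    rw [LinearMap.baseChange_mul, Module.End.mul_apply]
    exact iha (ihb hw)

variable [FiniteDimensional k T]

/-- **`End_K(K ⊗ T)` is the base change of `End_k(T)`** along `f ↦ f_K = 1 ⊗ f`
(`T` finite-dimensional): elementary endomorphisms go to elementary endomorphisms
(Mathlib: `Module.Basis.baseChange_end`, i.e. `Module.Basis.baseChange_linearMap`). [folklore] -/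
theorem isBaseChange_baseChangeHom :
    IsBaseChange K (Module.End.baseChangeHom k K T).toLinearMap := by
  classical
  exact isBaseChange_of_basis _ ((Module.finBasis k T).end)
    ((Algebra.TensorProduct.basis K (Module.finBasis k T)).end)
    fun ij => Module.Basis.baseChange_linearMap K (Module.finBasis k T) (Module.finBasis k T) ij

variable {G : Set (Module.End k T)}
  (hG : ∀ W : Submodule k T, (∀ g ∈ G, ∀ w ∈ W, g w ∈ W) →
    ∃ W' : Submodule k T, (∀ g ∈ G, ∀ w ∈ W', g w ∈ W') ∧ IsCompl W W')
include hG

/-- **Bicommutant over an extension field.** If `G` is completely reducible on the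
finite-dimensional `k`-space `T`, an operator on `K ⊗_k T` commuting with all `f_K`, `f` in the
commutant of `G`, lies in the `K`-span of the `a_K`, `a ∈ k[G]`: the commutation conditions are
`k`-linear equations whose solutions commute with extension of scalars
(`mem_span_image_of_forall_of_isBaseChange`), and over `k` they cut out `k[G]`
(`mem_adjoin_of_forall_commute`). [folklore] -/
theorem mem_span_baseChange_adjoin_of_forall_commute {x : Module.End K (K ⊗[k] T)}
    (hx : ∀ f : Module.End k T, (∀ g ∈ G, f * g = g * f) →
      x * f.baseChange K = f.baseChange K * x) :
    x ∈ Submodule.span K ((fun a : Module.End k T => a.baseChange K) ''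
      (Algebra.adjoin k G : Set (Module.End k T))) := by
  let C := {f : Module.End k T // ∀ g ∈ G, f * g = g * f}
  have key := mem_span_image_of_forall_of_isBaseChange (isBaseChange_baseChangeHom (T := T) K)
    (ι' := C) (fun f => LinearMap.mulRight k (f : Module.End k T))
    (fun f => LinearMap.mulLeft k (f : Module.End k T))
    (fun f => LinearMap.mulRight K ((f : Module.End k T).baseChange K))
    (fun f => LinearMap.mulLeft K ((f : Module.End k T).baseChange K))
    (fun f y => by simp [baseChangeHom_apply, LinearMap.baseChange_mul])
    (fun f y => by simp [baseChangeHom_apply, LinearMap.baseChange_mul]) (y := x)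
    (fun f => by simpa using hx f f.2)
  refine Submodule.span_mono (Set.image_mono ?_) key
  intro y hy
  exact mem_adjoin_of_forall_commute hG fun f hf => by simpa using hy ⟨f, hf⟩

/-- **Complete reducibility survives extension of scalars** (characteristic `0`). If `G` is
completely reducible on the finite-dimensional `k`-space `T` (`char k = 0`) and `K ⊇ k` is any
field, every `K`-subspace `W ⊆ K ⊗_k T` stable under the `g_K`, `g ∈ G`, has a complement `W'`
stable under every operator in the `K`-span of the `a_K`, `a ∈ k[G]` (in particular under the
`g_K`). Proof: `k[G]` is semisimple (`isSemisimpleRing_adjoin`), hence so are `K ⊗_k k[G]`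
(`Literature.RingTheory.SimpleModule.isSemisimpleRing_baseChange`, Pierce §10.7 Cor. b — this is
where characteristic `0` enters) and its image `S` in `End_K(K ⊗ T)`
(`RingHom.isSemisimpleRing_of_surjective`); `K ⊗ T` is then a semisimple `S`-module, `W` an
`S`-submodule, and an `S`-stable complement exists. [cite: Pierce1982, §10.7 Cor. b] -/
theorem exists_isCompl_of_forall_baseChange_apply_mem [CharZero k] (W : Submodule K (K ⊗[k] T))
    (hW : ∀ g ∈ G, ∀ w ∈ W, g.baseChange K w ∈ W) :
    ∃ W' : Submodule K (K ⊗[k] T),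
      (∀ s ∈ Submodule.span K ((fun a : Module.End k T => a.baseChange K) ''
          (Algebra.adjoin k G : Set (Module.End k T))), ∀ w ∈ W', s w ∈ W') ∧ IsCompl W W' := by
  set A := Algebra.adjoin k G with hA
  haveI : IsSemisimpleRing A := isSemisimpleRing_adjoin hG
  haveI : Module.Finite k A := Module.Finite.of_injective A.val.toLinearMap Subtype.val_injective
  haveI : IsSemisimpleRing (K ⊗[k] A) :=
    Literature.RingTheory.SimpleModule.isSemisimpleRing_baseChange k A K
  -- `K ⊗ A` acts on `K ⊗ T` through `c ⊗ a ↦ c • a_K`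
  let Ψ : K ⊗[k] A →ₐ[K] Module.End K (K ⊗[k] T) :=
    Algebra.TensorProduct.lift (Algebra.ofId K _) ((Module.End.baseChangeHom k K T).comp A.val)
      fun c a => Algebra.commutes c _
  have hΨ : ∀ (c : K) (a : A), Ψ (c ⊗ₜ[k] a) = c • (a : Module.End k T).baseChange K := by
    intro c a
    rw [Algebra.TensorProduct.lift_tmul, Algebra.ofId_apply, AlgHom.comp_apply, baseChangeHom_apply,
      Algebra.algebraMap_eq_smul_one, smul_mul_assoc, one_mul]
    rfl
  letI modΨ : Module (K ⊗[k] A) (K ⊗[k] T) := Module.compHom _ Ψ.toRingHom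
  have hsmul : ∀ (z : K ⊗[k] A) (w : K ⊗[k] T), z • w = Ψ z w := fun _ _ => rfl
  haveI : IsScalarTower K (K ⊗[k] A) (K ⊗[k] T) :=
    ⟨fun c z w => by rw [hsmul, hsmul, map_smul, LinearMap.smul_apply]⟩
  haveI : IsSemisimpleModule (K ⊗[k] A) (K ⊗[k] T) := inferInstance
  -- `W` is a `K ⊗ A`-submodule
  have hWS : ∀ (z : K ⊗[k] A), ∀ w ∈ W, z • w ∈ W := by
    intro z w hw
    rw [hsmul]
    induction z using TensorProduct.induction_on with
    | zero => simp
    | tmul c a =>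
      rw [hΨ, LinearMap.smul_apply]
      exact W.smul_mem c (baseChange_apply_mem_of_mem_adjoin K hW a.2 hw)
    | add x y hx hy =>
      rw [map_add, LinearMap.add_apply]
      exact W.add_mem hx hy
  let WS : Submodule (K ⊗[k] A) (K ⊗[k] T) :=
    { carrier := W
      add_mem' := W.add_mem
      zero_mem' := W.zero_mem
      smul_mem' := fun z w hw => hWS z w hw }
  obtain ⟨WS', hc⟩ := exists_isCompl WS
  refine ⟨WS'.restrictScalars K, fun s hs w hw => ?_, ?_⟩
  · induction hs using Submodule.span_induction generalizing w with
    | mem _ h =>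
      obtain ⟨a, ha, rfl⟩ := h
      have h1 : ((1 : K) ⊗ₜ[k] (⟨a, ha⟩ : A)) • w ∈ WS' := WS'.smul_mem _ hw
      rwa [hsmul, hΨ, one_smul] at h1
    | zero => simp
    | add x y _ _ hx hy => simpa using WS'.add_mem (hx w hw) (hy w hw)
    | smul c x _ hx => simpa using (WS'.restrictScalars K).smul_mem c (hx w hw)
  · have hW' : WS.restrictScalars K = W := rfl
    rw [← hW']
    rw [isCompl_iff, disjoint_iff, codisjoint_iff] at hc ⊢
    constructor
    · rw [← Submodule.restrictScalars_inf, hc.1, Submodule.restrictScalars_bot]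
    · rw [← Submodule.restrictScalars_sup, hc.2, Submodule.restrictScalars_top]

/-- The form used downstream: a complement stable under every operator on `K ⊗ T` commuting with
all `f_K`, `f` in the commutant of `G` (such operators lie in the `K`-span of the `a_K` by the
bicommutant theorem `mem_span_baseChange_adjoin_of_forall_commute`). [folklore] -/
theorem exists_isCompl_of_forall_baseChange_apply_mem' [CharZero k] (W : Submodule K (K ⊗[k] T))
    (hW : ∀ g ∈ G, ∀ w ∈ W, g.baseChange K w ∈ W) :
    ∃ W' : Submodule K (K ⊗[k] T),
      (∀ x : Module.End K (K ⊗[k] T), (∀ f : Module.End k T, (∀ g ∈ G, f * g = g * f) →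
        x * f.baseChange K = f.baseChange K * x) → ∀ w ∈ W', x w ∈ W') ∧ IsCompl W W' := by
  obtain ⟨W', hW', hc⟩ := exists_isCompl_of_forall_baseChange_apply_mem K hG W hW
  exact ⟨W', fun x hx => hW' x (mem_span_baseChange_adjoin_of_forall_commute K hG hx), hc⟩

end BaseChange

end Field

end Literature.AlgebraicGeometry.Motives

end
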